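import Mathlib
import Summits.QuantumFields.QCD.Theses.PauliWegnerSea
import Summits.QuantumFields.QCD.Theorems.PauliWegnerSeaFMClosureUnquenchedHopping
import Summits.QuantumFields.QCD.Theorems.PauliWegnerSeaFMClosureUnquenchedResolvent
import Summits.QuantumFields.QCD.Theorems.PauliWegnerSeaPauliBandLimit
import Summits.QuantumFields.QCD.Theorems.PauliWegnerSeaFMClosureUnquenchedDefs
import Summits.QuantumFields.QCD.Theorems.PauliWegnerSeaFMClosureUnquenchedFibreBandLawC1
import Summits.QuantumFields.QCD.Theorems.PauliWegnerSeaFMClosureUnquenchedTwoStarC1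
import Summits.QuantumFields.QCD.Theorems.PauliWegnerSeaFMClosureUnquenchedClosureC1
import Summits.QuantumFields.QCD.Theorems.PauliWegnerSeaFMClosureUnquenchedSideWitnessC1

/-!
# Line `von-mises-circles` — skeleton for crux `PauliWegnerSea.FMClosureUnquenched` (stmt-QuantumFields-11512)

Crux (fixed, by name): `FMClosureUnquenched = FibreCofactorDomination → TiltedFlatness → Core`,
`Core = ∀ Nf reg m > 0, Input → Conclusion` (one-scale phase-quenched shell bound ⇒ clause (ii) of
`MobilityGap`).  Idea card `Cruxes/FMClosureUnquenched/Ideas/von-mises-circles.md` (ideator 2, round 1;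
triage r1-1/2/3: pass — "support module: the fibre input of whichever outward line is picked"); line card
`Cruxes/FMClosureUnquenched/Lines/von-mises-circles.md`.

## Shape: a GRAFT on the picked line

The lead picked `thick-collar-far-stability` (`PICKED.md`) and its wave 1 (`LEAD-c1.md`) returned
`stub_twoStar : K1 → K3 → ∀ Nf, TwoStarBounds Nf` **blocked**: K1 as typed carries the extensive factor
`(1 + n_w)`, K3 speaks only for `β ≥ 0` and masses in `[-2,2]`, and (Tdec)/(T1) need a fibre decoupling
the route never filed.  This line is that skeleton with `stub_twoStar` OPENED ALONG ABELIAN CIRCLES: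

* `stub_fibreBandLaw`, first conjunct `CircleLaw` (M, the lever) — ONE-VARIABLE harmonic analysis: under any circle law
  `∝ e^{h(θ)} |J(θ)| dθ` with `h` a real trigonometric polynomial of bounded degree and `|h| ≤ κ`, `J` a
  trigonometric polynomial of bounded degree, every trigonometric polynomial `Q` of degree `≤ d` is
  FLAT (`sup |Q| ≤ C (1+κ)^p · mean |Q|`) and has NEGATIVE MOMENTS against its sup
  (`mean |Q|^{-s} ≤ C (1+κ)^p (sup |Q|)^{-s}`, `s ≤ s₀(d) < 1/(2d)`), constants depending on the
  degrees only.  (Planning found that unimodality — the von Mises shape of first-harmonic tilts — is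
  not needed for these SUP forms: any bounded-degree Gibbs tilt has density `≤ C κ^{1/2 + d_J}` on the
  circle; so no `2 ≤ L` hypothesis survives anywhere below.)
* `stub_fibreBandLaw`, second conjunct `FibreBandLaw` (L, the iteration) — on the fibre of `≤ n` links with the outside frozen, under
  the Wilson weight `e^{-β S_W}` tilted by `|P|` for ANY fibre polynomial `P` (e.g. `|det diracMatrix|`,
  all flavours, all masses) and for every `β ∈ ℝ`: flatness and negative moments of every fibre
  polynomial `Q` (depleted determinants, adjugate entries), constants `C(n,d) (1+|β|)^{p(n,d)}` —
  uniform in the volume, the outside field and the masses.  Mechanism: disintegrate product Haar along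
  the right cosets of the one-link circle letters `P₀₁, R₀₁, P₁₂, R₁₂` (the nine-letter words of the
  LANDED `Theorems/PauliWegnerSeaGluonicCompletionSu3CircleWord.lean` generate `SU(3)`; the averaging
  step is the LANDED `…HaarCurveStep.lean` in integral form), apply the circle law conditionally, and
  push `sup`/`inf` through the conditional expectations in the monotone direction (no measurable
  selection): after `9·n` letters the sup over all words is the sup over the fibre.
* `stub_cofactorDomination` (L) — K1♭ = `LocalCofactorDomination`, K1 IN UNIFORM SIDE-MATRIX FORM (= the
  lead's `K2Repaired.FibreCofactorDominationUniform` extended to admissible side matrices, to `x = y`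
  and to `m₀ ∈ [-9,1]`); the deterministic input every outward line consumes; recommended for promotion
  to a route item by the tenure planner.
* `stub_twoStar` (M–L) — `FibreBandLaw → LocalCofactorDomination → ∀ Nf, TwoStarBounds Nf`, the picked
  line's packaged two-star statement VERBATIM (all `β ∈ ℝ`, probe mass `∈ [-9,1]`, all sea masses, all
  `S`), by Hölder / reverse-Hölder glue on each two-star fibre: (T5) = K1♭ + Neg; (Tdec) = Cauchy–Schwarz +
  Neg for the depleted factor + reverse Hölder (Flat + Neg) for the full factor; (T1) = (T5)
  conditionally on the stars of `u', v` (the inside and far factors are constant there); (T0) =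
  Hölder³ + Neg, positivity of the weight from the landed a.e. non-vanishing of `det`.
* `stub_farStability`, `stub_unitShell`, `stub_inward`, `stub_closure` — the picked line's four open
  downstream stubs, BYTE-IDENTICAL (names, signatures, packaged `Prop`s), so that one registry serves
  both lines; `stub_resolvent` (p77083) and `stub_hopping` (p75265) are the landed theorems, imported.

Composition `FMClosureUnquenched_of : <type of stub_fibreBandLaw> → … → <type of stub_closure> →
FMClosureUnquenched` (sorry-free, hypotheses literally the seven stub statements), and
`FMClosureUnquenched_of_stubs : FMClosureUnquenched` instantiates it with the seven `stub_*` (the theorem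
the layer audit reads).  K1 and K3 (the crux's own hypotheses) are threaded to `stub_farStability`
exactly as in the picked line; the fibre half no longer leans on them (it proves more: `β ∈ ℝ`, all
masses — LEAD-c1 points 1–2 for the fibre package), and as a by-product `FibreBandLaw` with
`Q = P = det diracMatrix` gives route item `TiltedFlatness` (stmt-14070) in negative-moment form.

## Disproof.lean / negatives honoured (cycle 2 file, 05:05Z)
§1 guard (`refutation_cost`): nothing here is `¬K2`; §2 decoration: the fibre stubs are mass-blind by
construction (degree, not mass); §4 A5 corner: isolated as `stub_unitShell` (shared); §5 A6: `stub_inward`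
(shared); §6 `outward_bootstrap`: consumed inside `stub_closure` via the lead's landed
`SubharmonicIterationDecay`; §8 non-vacuity: consistent (heavy sea is in the hopping window); §9 Targets:
the five picked-line stubs un-broken — the four reused here verbatim.  No `_false_without_` theorem and no
landed `Theorems/FMClosureUnquenched/Negative/` lemma exist, so no stub instantiates one.  Negatives index
(9494, 9599, 9603, 9665: MultibosonBridge ladders, diagonal-mirror RP, adaptive coarse system): untouched.

## Reshape (lead gen 1, prover-line-stmt-QuantumFields-11512-1, 2026-08-16)

Seven registered stubs, same composition idea: `stub_circleLaw` (1a, `∀ d dJ dh, CircleLaw d dJ dh`, held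
by the lead) and `stub_fibreBandLaw` (1b, `(∀ d dJ dh, CircleLaw d dJ dh) → FibreBandLaw`) replace the
former conjunction; `stub_corners` = former `stub_unitShell ∧ stub_inward` (the A5/A6 corners of the crux as
typed, mooted by `K2Repaired`, carried unchanged so that `FMClosureUnquenched_of_stubs` still concludes the
crux by name); `stub_deterministic` = former `stub_cofactorDomination` ∧ the NEW `SideWitness` (one invertible
field per admissible side matrix and probe mass), feeding the NEW clause (Tinv) of `TwoStarBounds` (a.e.
invertibility of the side matrices the resolvent identities invert — a junk-value gap of both parent
skeletons: `Matrix.inv` is `0` at singular matrices and (Rfwd)/(R2) carry invertibility hypotheses);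
`stub_twoStar` gains the hypothesis `SideWitness`; `stub_farStability`, `stub_closure` unchanged in text
(but `TwoStarBounds` now carries (Tinv)).

Sections §0–§2 below (crux quantities, side-matrix vocabulary, the packaged stub predicates) are copied
VERBATIM from `Lines/thick_collar_far_stability.lean` (sha256 57b57a2a66dc…, the lead's registered
skeleton); §3 is this line's content (with two sorry-free bridge lemmas showing the LANDED
`PauliBandLimit_proof` feeds `IsTrigPoly 4` / the `IsFibrePoly` orbit condition); §4 the registered stubs;
§5 the kernel-checked composition.
-/

noncomputable section

namespace Summit.QuantumFields.QCD.Cruxes.FMClosureUnquenched.VonMisesCircles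

open scoped BigOperators
open MeasureTheory Filter
open Literature.MathematicalPhysics.QuantumFieldTheory Literature.MathematicalPhysics.QuantumLattice
  Literature.Probability.LatticeModels
open Summit.QuantumFields.QCD.Theorems.VonMisesCircles

local notation "𝔾" => Matrix.specialUnitaryGroup (Fin 3) ℂ
/-! ## §0–§3 Vocabulary

All definitions of §0–§3 of the registered skeleton (crux quantities, side-matrix vocabulary, packaged stub
predicates, circle / fibre vocabulary: `bareMass … LocalCofactorDomination`, `SideWitness`) now live VERBATIM in the
LANDED `Theorems/PauliWegnerSeaFMClosureUnquenchedDefs.lean` (p97650, namespace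
`Summit.QuantumFields.QCD.Theorems.VonMisesCircles`, opened above), so that stub theorems land under `Theorems/` by
name and registered signature; the registered signature TEXTS are unchanged. -/

/-! ## §4 Registered stubs -/

/- RESHAPE (seat c1-0 integration, 2026-08-16): the former stub 1a `stub_circleLaw` (1-D circle law) is DROPPED —
the fibre band law below is proved outright (landed p105781) without it, and the composition consumes only
`FibreBandLaw`.  The circle law remains a true and possibly useful 1-D statement (its registry record is held by seat -1). -/


/-- **stub 1b — the fibre band law FROM the circle law (L; the word iteration; measure theory on the
compact group `SU(3)^R` over landed tree tools — RESHAPE gen 1: the former single stub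
`(∀ d dJ dh, CircleLaw d dJ dh) ∧ FibreBandLaw` is split into `stub_circleLaw` (the 1-D lever, held by the
lead) and this implication, so that the two halves are proved in parallel).**  Proof plan: steps (1)–(5) of
the FIBRE BAND LAW paragraph above (coset formula by right-invariance of product Haar + Fubini; the
conditional law on a letter orbit is a `CircleLaw d d 2` law; (Neg)/(Flat) steps by pushing `inf`/`sup`
through the next conditional expectation; a surjective nine-letter word per link, LANDED
`stub_eulerWord`/`stub_su3CircleWord`; (AE) from the landed `HaarCurveStep`/`HaarWordIterate` machinery). -/
/- REGISTERED IN UNFOLDED VOCABULARY: hypothesis = the text of `stub_circleLaw`, conclusion =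
`FibreBandLaw` with `IsFibrePoly`/`IsTrigPoly` inlined and `𝔾` spelled out; `fibreBandLaw_of_circleLaw`
below is the def-based form. -/
theorem stub_fibreBandLaw :
    (∀ d dJ dh : ℕ,
      ∃ s₀ C p : ℝ, 0 < s₀ ∧ 0 < C ∧ ∀ (κ : ℝ) (h : ℝ → ℝ) (J Q : ℝ → ℂ),
        0 ≤ κ →
        (∃ c : ℤ → ℂ, ∀ θ : ℝ, (h θ : ℂ) =
          ∑ k ∈ Finset.Icc (-(dh : ℤ)) dh, c k * Complex.exp ((k : ℂ) * (θ : ℂ) * Complex.I)) →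
        (∀ θ, |h θ| ≤ κ) →
        (∃ c : ℤ → ℂ, ∀ θ : ℝ, J θ =
          ∑ k ∈ Finset.Icc (-(dJ : ℤ)) dJ, c k * Complex.exp ((k : ℂ) * (θ : ℂ) * Complex.I)) →
        (∃ θ, J θ ≠ 0) →
        (∃ c : ℤ → ℂ, ∀ θ : ℝ, Q θ =
          ∑ k ∈ Finset.Icc (-(d : ℤ)) d, c k * Complex.exp ((k : ℂ) * (θ : ℂ) * Complex.I)) →
        let w : ℝ → ℝ := fun θ => Real.exp (h θ) * ‖J θ‖
        (∀ θ₀ : ℝ, ‖Q θ₀‖ ≤ C * (1 + κ) ^ p *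
          ((∫ θ in (0 : ℝ)..(2 * Real.pi), ‖Q θ‖ * w θ) / (∫ θ in (0 : ℝ)..(2 * Real.pi), w θ))) ∧
        (∀ s : ℝ, 0 < s → s ≤ s₀ →
          IntervalIntegrable (fun θ => ‖Q θ‖ ^ (-s) * w θ) MeasureTheory.volume 0 (2 * Real.pi) ∧
          (∫ θ in (0 : ℝ)..(2 * Real.pi), ‖Q θ‖ ^ (-s) * w θ) / (∫ θ in (0 : ℝ)..(2 * Real.pi), w θ) ≤
            C * (1 + κ) ^ p * (⨆ θ : ℝ, ‖Q θ‖) ^ (-s))) →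
    ∀ n d : ℕ, ∃ s₀ C p : ℝ, 0 < s₀ ∧ 0 < C ∧
      ∀ (N : ℕ) [NeZero N] (R : Finset (Edge 4 N)), R.card ≤ n →
      ∀ (U : GaugeConfig 4 N (Matrix.specialUnitaryGroup (Fin 3) ℂ)) (β : ℝ)
        (P Q : GaugeConfig 4 N (Matrix.specialUnitaryGroup (Fin 3) ℂ) → ℂ),
      (Continuous P ∧ ∀ (W : GaugeConfig 4 N (Matrix.specialUnitaryGroup (Fin 3) ℂ)) (e : Edge 4 N)
          (V B : Matrix.specialUnitaryGroup (Fin 3) ℂ) (T : ℝ → Matrix.specialUnitaryGroup (Fin 3) ℂ),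
        (∀ θ : ℝ, ((T θ : Matrix.specialUnitaryGroup (Fin 3) ℂ) : Matrix (Fin 3) (Fin 3) ℂ) =
          Matrix.diagonal ![Complex.exp (θ * Complex.I), Complex.exp (-(θ * Complex.I)), 1]) →
        ∃ c : ℤ → ℂ, ∀ θ : ℝ, P (Function.update W e (W e * (V * T θ * V⁻¹) * B)) =
          ∑ k ∈ Finset.Icc (-(d : ℤ)) d, c k * Complex.exp ((k : ℂ) * (θ : ℂ) * Complex.I)) →
      (Continuous Q ∧ ∀ (W : GaugeConfig 4 N (Matrix.specialUnitaryGroup (Fin 3) ℂ)) (e : Edge 4 N)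
          (V B : Matrix.specialUnitaryGroup (Fin 3) ℂ) (T : ℝ → Matrix.specialUnitaryGroup (Fin 3) ℂ),
        (∀ θ : ℝ, ((T θ : Matrix.specialUnitaryGroup (Fin 3) ℂ) : Matrix (Fin 3) (Fin 3) ℂ) =
          Matrix.diagonal ![Complex.exp (θ * Complex.I), Complex.exp (-(θ * Complex.I)), 1]) →
        ∃ c : ℤ → ℂ, ∀ θ : ℝ, Q (Function.update W e (W e * (V * T θ * V⁻¹) * B)) =
          ∑ k ∈ Finset.Icc (-(d : ℤ)) d, c k * Complex.exp ((k : ℂ) * (θ : ℂ) * Complex.I)) →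
      let refit : GaugeConfig 4 N (Matrix.specialUnitaryGroup (Fin 3) ℂ) →
          GaugeConfig 4 N (Matrix.specialUnitaryGroup (Fin 3) ℂ) := fun W e => if e ∈ R then W e else U e
      let wt : GaugeConfig 4 N (Matrix.specialUnitaryGroup (Fin 3) ℂ) → ℝ := fun W =>
        Real.exp (-(β * wilsonAction (fundamentalRep (Fin 3)) (refit W))) * ‖P (refit W)‖
      let haar : MeasureTheory.Measure (GaugeConfig 4 N (Matrix.specialUnitaryGroup (Fin 3) ℂ)) :=
        MeasureTheory.Measure.pi fun _ => haarProbability (Matrix.specialUnitaryGroup (Fin 3) ℂ)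
      let Z : ℝ := ∫ W, wt W ∂haar
      (∃ W, P (refit W) ≠ 0) →
        ((∃ W, Q (refit W) ≠ 0) → ∀ᵐ W ∂haar, Q (refit W) ≠ 0) ∧
        (∀ W₀ : GaugeConfig 4 N (Matrix.specialUnitaryGroup (Fin 3) ℂ),
          ‖Q (refit W₀)‖ ≤ C * (1 + |β|) ^ p * ((∫ W, ‖Q (refit W)‖ * wt W ∂haar) / Z)) ∧
        (∀ s : ℝ, 0 < s → s ≤ s₀ →
          MeasureTheory.Integrable (fun W => ‖Q (refit W)‖ ^ (-s) * wt W) haar ∧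
          (∫ W, ‖Q (refit W)‖ ^ (-s) * wt W ∂haar) / Z ≤
            C * (1 + |β|) ^ p * (⨆ W : GaugeConfig 4 N (Matrix.specialUnitaryGroup (Fin 3) ℂ), ‖Q (refit W)‖) ^ (-s)) :=
  -- CLOSED (landed p105781, `Theorems/PauliWegnerSeaFMClosureUnquenchedFibreBandLawC1.lean` + Aux1/Aux2, seat c1-0):
  -- proved OUTRIGHT from the landed circle-transport machinery of K3 (the CircleLaw hypothesis is unused;
  -- `VonMisesCirclesC1.c1_fibreBandLaw : FibreBandLaw` is the hypothesis-free form).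
  _root_.Summit.QuantumFields.QCD.Theorems.VonMisesCirclesC1.stub_fibreBandLaw

/-- Def-based form of stub 1b (definitional unfolding). -/
theorem fibreBandLaw_of_circleLaw : (∀ d dJ dh : ℕ, CircleLaw d dJ dh) → FibreBandLaw :=
  stub_fibreBandLaw

/-- **`FibreBandLaw` holds outright** (landed `VonMisesCirclesC1.c1_fibreBandLaw`, p105781: the registered let-free
form, specialised back to the `let`s of the definition by `rfl`). -/
theorem fibreBandLaw_holds : FibreBandLaw := by
  intro n d
  obtain ⟨s₀, C, p, h0, hC, h⟩ := _root_.Summit.QuantumFields.QCD.Theorems.VonMisesCirclesC1.c1_fibreBandLaw n d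
  refine ⟨s₀, C, p, h0, hC, ?_⟩
  intro N _ R hR U β P Q hP hQ
  exact h N R hR U β P Q hP hQ _ rfl _ rfl _ rfl _ rfl

/-- **stub 2a — uniform cofactor domination K1♭ `LocalCofactorDomination` (OPEN; held by the lead of seat c1).**
One constant `C₀` with `sup_fibre ‖adj(D_A ⊕ 1)_{xy}‖₁ ≤ C₀ · sup_fibre |det(D_A ⊕ 1)|` on every two-star fibre, every
admissible side of every odd torus, every background, probe mass `m₀ ∈ [-9,1]`.  Status (LEAD-c1-1, LEAD-c1-2): exact Schur
reduction to a `12|X|`-dimensional family `Σ(W) = D_XX(W) − H_out(W)·M·H_in(W)` per background; numerics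
`R = sup‖adj Σ‖/sup|det Σ| = O(10)` for random/smooth backgrounds on `3⁴`; the only identified failure mechanism is a
background whose exterior operator at `m₀ = -4` makes `B(W) = H_out M H_in` rank-deficient uniformly in `W`. -/
theorem stub_localCofactorDomination : LocalCofactorDomination := by
  sorry

/-- **stub 2 — the deterministic inputs: uniform cofactor domination K1♭ AND side-matrix witnesses
(RESHAPE gen 1: `LocalCofactorDomination ∧ SideWitness`; L; deterministic linear algebra; the line's risk
concentrate, see `LocalCofactorDomination`, `SideWitness`; the `SideWitness` half is landable separately as a
registered sub-goal).**  Not this idea's mechanism but the deterministic input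
every outward line consumes; = the lead's proposed restatement of route item K1
(`K2Repaired.FibreCofactorDominationUniform`) extended to admissible side matrices, `x = y` and
`m₀ ∈ [-9,1]` (trivial by Neumann series outside `(-8.1, 0.1)`).  Recommended to the tenure planner
for PROMOTION to a route item (then this stub becomes an admissible hypothesis by name).  Route:
K1's ModeByMode/TwoStarSchur plan (`adj = det · G`, γ₅-hermiticity of `D_A`, two stars shake every mode
cored at `x` or `y`).  Cheapest falsifier: the route's next two-star test WITHOUT the `n_w` allowance;
even-box side matrices at `m₀ = -4`. -/
theorem stub_deterministic : LocalCofactorDomination ∧ SideWitness :=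
  -- RESHAPE (seat c1-0, 2026-08-16): the `SideWitness` half is CLOSED (landed p120123,
  -- `Theorems/PauliWegnerSeaFMClosureUnquenchedSideWitnessC1.lean` + Aux1–10: the flow argument, no mass restriction);
  -- the K1♭ half is the separate open stub `stub_localCofactorDomination` below.
  ⟨stub_localCofactorDomination, _root_.Summit.QuantumFields.QCD.Theorems.VonMisesCirclesC1.c1_sideWitness⟩

/-- **stub 3 — the two-star package from the fibre band law and K1♭ (M–L; replaces the picked line's
blocked `stub_twoStar`).**  `FibreBandLaw → LocalCofactorDomination → ∀ Nf, TwoStarBounds Nf` (the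
packaged predicate of §2, VERBATIM the lead's: all `β ∈ ℝ`, probe mass `∈ [-9,1]`, all sea masses,
all `S`).  Content: (b) band limits — `det`/adjugate entries of `sideMatrix A (wilsonD · m)` and
`det diracMatrix` are fibre polynomials of degree `4` / `4 N_f` (rank argument of the LANDED
`PauliWegnerSeaPauliBandLimit(DetRank)`: the `e^{±iθ}`-coefficients of `W_e V T(θ) V⁻¹ B` have rank one;
continuity: polynomial entries);
(c) conditioning of `ν_S = ‖det diracMatrix‖ · μ_W / Z` on the links off `star(x) ∪ star(y)` (density
`e^{-βS}` × product Haar; the conditional is the `FibreBandLaw` law with `R` = the `≤ 16` star links,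
`P = det diracMatrix`), then per fibre: (T5) `E‖G_f(x,y)‖^s = E[‖adj_f‖^s |det_f|^{-s}] ≤
(C₀ sup|det_f|)^s · C_β (sup|det_f|)^{-s}` (K1♭ + Neg); (Tdec) Cauchy–Schwarz, `E X² ≤ C₀^{2s} C_β` for
the depleted factor (K1♭ on the side matrix + Neg, `2s ≤ s₀`) and reverse Hölder
`(E Y²)^{1/2} ≤ 144 C_β^{3/2} E Y` for the full factor `Y = ‖adj_cd‖^s |det_f|^{-s}` (upper: Neg; lower:
Flat for the adjugate entry of largest sup and `|a|^s ≥ |a| sup^{s-1}`); (T1) = (T5) on the two-star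
fibre of `(u', v)`, where the inside factor `‖G_W(x,u)‖^s` and the far factor `‖G_{Λᶜ}(v',y)‖^s` are
CONSTANT (no link inside `W` or inside `Λᶜ` is incident to `u'` or `v`); (T0) `0 < Z` from the landed
a.e. non-vanishing of `det` (`stub_detNonvanishing` + one configuration with `det ≠ 0`, the lead's
`TwistedFreeWilsonDirac`), integrability of triple products by Hölder³ + Neg (`3s ≤ s₀`);
(d) integrate the fibre bounds over the outside (tower property); (e) the torus `S = 0` (`L = 1`, four
links) is INSIDE `FibreBandLaw` (second harmonics allowed, `dh = 2`).  Output exponent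
`s₀ = s₀(FibreBandLaw 16 (4N_f+4))/3`.  Why it might fail: bookkeeping only; the mathematics that can
fail sits in stubs 1–2.  Size M–L in Lean (disintegration of `wilsonMeasure` over a link subset is the
long part; `LatticeGaugeDLR` has the specification). -/
theorem stub_twoStar :
    FibreBandLaw → LocalCofactorDomination → SideWitness → ∀ Nf : ℕ, TwoStarBounds Nf :=
  -- CLOSED (landed p105388, `Theorems/PauliWegnerSeaFMClosureUnquenchedTwoStarC1.lean` + Aux1–7, seat c1-0).
  _root_.Summit.QuantumFields.QCD.Theorems.VonMisesCirclesC1.stub_twoStar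

/-- stub 4 (XL, HARDEST of the whole line; SHARED with the picked line, byte-identical — the one property of
the phase-quenched gauge measure replacing independence; held by the lead). K1, K3 stay as hypotheses
for registry identity; this line's (T0) no longer needs them. -/
theorem stub_farStability :
    Summit.QuantumFields.QCD.Theses.PauliWegnerSea.FibreCofactorDomination →
      Summit.QuantumFields.QCD.Theses.PauliWegnerSea.TiltedFlatness →
        ∀ Nf : ℕ, FarStability Nf := by
  sorry

/-- stub 3 — CLOSED (landed p77083, `Theorems/PauliWegnerSeaFMClosureUnquenchedResolvent.lean`, 399 lines,
`cT = 4`: resolvent identities `M⁻¹ - N⁻¹ = N⁻¹ (N - M) M⁻¹ = M⁻¹ (N - M) N⁻¹`, block-diagonality of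
`(D_A ⊕ 1)⁻¹`, support of the cross-cut hops on adjacent boundary pairs, expand-and-bound). Registered in
unfolded vocabulary (= `CollarResolventBounds` verbatim); the skeleton now imports the landed theorem. -/
theorem stub_resolvent :
    ∃ cT : ℝ, 0 < cT ∧ ∀ (S : ℕ) (U : GaugeConfig 4 (2 * S + 1) (Matrix.specialUnitaryGroup (Fin 3) ℂ))
        (m₀ : ℝ) (x : TorusSite 4 (2 * S + 1)),
        let D : Matrix (TorusSite 4 (2 * S + 1) × Fin 3 × Fin 4) (TorusSite 4 (2 * S + 1) × Fin 3 × Fin 4) ℂ :=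
          wilsonDirac (fundamentalRep (Fin 3)) U m₀ 1
        let bn : Matrix (TorusSite 4 (2 * S + 1) × Fin 3 × Fin 4) (TorusSite 4 (2 * S + 1) × Fin 3 × Fin 4) ℂ →
            TorusSite 4 (2 * S + 1) → TorusSite 4 (2 * S + 1) → ℝ :=
          fun M y z => ∑ a : Fin 3, ∑ i : Fin 4, ∑ b : Fin 3, ∑ j : Fin 4, ‖M (y, a, i) (z, b, j)‖
        let side : Finset (TorusSite 4 (2 * S + 1)) →
            Matrix (TorusSite 4 (2 * S + 1) × Fin 3 × Fin 4) (TorusSite 4 (2 * S + 1) × Fin 3 × Fin 4) ℂ :=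
          fun A => Matrix.of fun p q => if p.1 ∈ A ∧ q.1 ∈ A then D p q else if p = q then 1 else 0
        let ball : ℕ → Finset (TorusSite 4 (2 * S + 1)) := fun r =>
          (box 4 r).image fun w => x + Torus.proj (2 * S + 1) w
        let sphere : ℕ → Finset (TorusSite 4 (2 * S + 1)) := fun r =>
          ((box 4 r).filter fun w : Literature.Probability.LatticeModels.Site 4 =>
              ∃ i, w i = (r : ℤ) ∨ w i = -(r : ℤ)).image
            fun w => x + Torus.proj (2 * S + 1) w
        let ebox : ℕ → Finset (TorusSite 4 (2 * S + 1)) := fun r =>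
          (Fintype.piFinset fun _ : Fin 4 => Finset.Icc (-(r : ℤ) - 1) r).image
            fun w => x + Torus.proj (2 * S + 1) w
        let boxIn : ℕ → Finset (TorusSite 4 (2 * S + 1)) := fun r =>
          ((Fintype.piFinset fun _ : Fin 4 => Finset.Icc (-(r : ℤ) - 1) r).filter
              fun w : Literature.Probability.LatticeModels.Site 4 =>
                ∃ i, w i = -(r : ℤ) - 1 ∨ w i = (r : ℤ)).image
            fun w => x + Torus.proj (2 * S + 1) w
        let boxOut : ℕ → Finset (TorusSite 4 (2 * S + 1)) := fun r =>
          ((Fintype.piFinset fun _ : Fin 4 => Finset.Icc (-(r : ℤ) - 2) (r + 1)).filter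
              fun w : Literature.Probability.LatticeModels.Site 4 =>
                ∃ i, w i = -(r : ℤ) - 2 ∨ w i = (r : ℤ) + 1).image
            fun w => x + Torus.proj (2 * S + 1) w
        (∀ r : ℕ, 1 ≤ r → r + 1 ≤ S → ∀ z : TorusSite 4 (2 * S + 1), z ∉ ball r →
          (side ((ball r)ᶜ)).det ≠ 0 →
            bn D⁻¹ x z ≤
              cT * ∑ p ∈ sphere r, ∑ p' ∈ sphere (r + 1), bn D⁻¹ x p * bn (side ((ball r)ᶜ))⁻¹ p' z) ∧
        ∀ ℓ : ℕ, 1 ≤ ℓ → ℓ + 2 ≤ S →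
          (∀ u : TorusSite 4 (2 * S + 1), u ∈ ebox ℓ → D.det ≠ 0 →
            bn (side (ebox ℓ))⁻¹ x u ≤
              bn D⁻¹ x u +
                cT * ∑ w' ∈ boxOut ℓ, ∑ w ∈ boxIn ℓ, bn D⁻¹ x w' * bn (side (ebox ℓ))⁻¹ w u) ∧
          (3 * ℓ + 4 ≤ S →
            (∀ v' y : TorusSite 4 (2 * S + 1), v' ∉ ebox (3 * ℓ + 2) → y ∉ ebox (3 * ℓ + 2) →
              D.det ≠ 0 →
                bn (side ((ebox (3 * ℓ + 2))ᶜ))⁻¹ v' y ≤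
                  bn D⁻¹ v' y +
                    cT * ∑ w' ∈ boxOut (3 * ℓ + 2), ∑ w ∈ boxIn (3 * ℓ + 2),
                      bn (side ((ebox (3 * ℓ + 2))ᶜ))⁻¹ v' w' * bn D⁻¹ w y) ∧
            (∀ y : TorusSite 4 (2 * S + 1), y ∉ ebox (3 * ℓ + 2) →
              (side (ebox ℓ)).det ≠ 0 → (side ((ebox (3 * ℓ + 2))ᶜ)).det ≠ 0 →
                bn D⁻¹ x y ≤
                  cT ^ 2 * ∑ u ∈ boxIn ℓ, ∑ u' ∈ boxOut ℓ,
                    ∑ v ∈ boxIn (3 * ℓ + 2), ∑ v' ∈ boxOut (3 * ℓ + 2),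
                      bn (side (ebox ℓ))⁻¹ x u * bn D⁻¹ u' v *
                        bn (side ((ebox (3 * ℓ + 2))ᶜ))⁻¹ v' y)) :=
  _root_.Summit.QuantumFields.QCD.Theorems.ThickCollarFarStability.stub_resolvent



/-- CLOSED stub of the picked line (landed p75265, `Theorems/PauliWegnerSeaFMClosureUnquenchedHopping.lean`, 308 lines:
Neumann series for both signs of `m₀ + 4`, `C = 1440`, `μ = log(41/40)`; `wilsonDirac_eq_sub_sum_wilsonHop`,
`l2_opNorm_wilsonHop_le`, the cyclic-distance toolkit of `WilsonPropagatorHeavyMass`). Registered in unfolded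
vocabulary (= `∀ Nf, HoppingDecay Nf` verbatim); the skeleton now imports the landed theorem. -/
theorem stub_hopping : ∀ Nf : ℕ,
    ∃ C μ : ℝ, 0 ≤ C ∧ 0 < μ ∧ ∀ (β : ℝ) (mq : Fin Nf → ℝ) (f : Fin Nf), (41 / 10 : ℝ) ≤ |mq f + 4| →
        ∀ (S : ℕ) (s : ℝ), 0 < s → s < 1 →
          ∀ v : Literature.Probability.LatticeModels.Site 4, v ∈ box 4 S →
            (∫ U : GaugeConfig 4 (2 * S + 1) (Matrix.specialUnitaryGroup (Fin 3) ℂ),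
                ‖(diracMatrix U mq).det‖ *
                  (∑ a : Fin 3, ∑ i : Fin 4, ∑ b : Fin 3, ∑ j : Fin 4,
                    ‖(diracMatrix U mq)⁻¹ (quarkEquiv (f, (Torus.proj (2 * S + 1) 0, a, i)))
                      (quarkEquiv (f, (Torus.proj (2 * S + 1) (v), b, j)))‖) ^ s
                ∂(wilsonMeasure (fundamentalRep (Fin 3)) β)) /
              (∫ U : GaugeConfig 4 (2 * S + 1) (Matrix.specialUnitaryGroup (Fin 3) ℂ),
                ‖(diracMatrix U mq).det‖ ∂(wilsonMeasure (fundamentalRep (Fin 3)) β)) ≤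
            C * Real.exp (-(μ * s * ‖v‖)) :=
  _root_.Summit.QuantumFields.QCD.Theorems.ThickCollarFarStability.stub_hopping


/-- **stub 6 — the two over-quantified CORNERS of the crux as typed (RESHAPE gen 1: the former shared
stubs `stub_unitShell` (A5: `ℓ₀ = 1 ∧ β_k → 0`, a strong-coupling log-moment sign) and `stub_inward`
(A6: the inward window `‖v‖ < ℓ₀(k)`, no mechanism off the reflection-positive locus) merged into ONE
registered statement; both are mooted by the restatement `K2Repaired` (`2 ≤ ℓ₀`, outward-only conclusion)
and neither is attacked by this line — they are carried so that the composition still concludes the crux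
AS TYPED by name).** -/
theorem stub_corners :
    (∀ Nf : ℕ, UnitShellLowerBound Nf) ∧
      (∀ (Nf : ℕ) (reg : QCDRegularisation Nf) (m : Fin Nf → ℝ), (∀ f, 0 < m f) →
        InwardExtension Nf reg m) := by
  sorry

/-- stub 7 (SHARED with the picked line, byte-identical; L as formalisation, M as mathematics — ASFH Thm 2/3 transplanted): from the five inputs
and the typed `Input`, (a) lower the input's exponent to `s' = min(s, s₀, s₀')` by Jensen (ν is a
probability measure; T0), keeping room `q s₀`; (b) translation invariance of `pqE` (input at centre `0`
⇒ at every centre); (c) flavour reduction `(diracMatrix U mq)⁻¹ ↦ (wilsonD U (mq f))⁻¹` under the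
weight; (d) per step `k` and flavour `f`: hopping window ⇒ `stub_hopping` (`ℓ₀' = 0`); else if
`ℓ₀(k) = 1 ∧ |β_k| ≤ β₀` ⇒ contradiction with `stub_unitShell`; else `Θ_k = ℓ₀(1+|β_k|) ≥
min(2, 1+β₀) > 1` and the bootstrap runs: conversion of the shell input into the exit moment
(Rin + Tdec + one forward step Rfwd + Tdec), one-step same-domain subharmonicity for
`y ∉ Λ(x) = ebox(x,3ℓ₀+2)` (R2 + T1 + FarStability + Rout + Tdec) with `b_k ≤ C Θ_k^{c - θ q s₀}`,
choice of ONE `q` making `Ξ₀ b_k ≤ 1` and `b_k ≤ 1/2`, iteration ⇒ `E ≤ b_k^{‖v‖/(3ℓ₀+4)}` for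
`‖v‖ ≥ 3ℓ₀+5`, the no-rate one-step bound (Rfwd + Tdec) on `ℓ₀ < ‖v‖ ≤ 3ℓ₀+4` (and on the whole
exterior when the collar does not fit), and the rate arithmetic `|log b_k|/(3ℓ₀+4) ≥ δ a_k` from
`ℓ₀ a_k ≤ K₀(1+|log a_k|)`; (e) a.e. invertibility of the side matrices actually inverted.
Output: `OutwardDecayWith` with `ℓ₀'(k,f) ∈ {0, ℓ₀(k)}`. Held by the lead. -/
theorem stub_closure :
    ∀ (Nf : ℕ) (reg : QCDRegularisation Nf) (m : Fin Nf → ℝ), (∀ f, 0 < m f) →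
      TwoStarBounds Nf → FarStability Nf → CollarResolventBounds → UnitShellLowerBound Nf →
        HoppingDecay Nf → Input Nf reg m →
          ∃ (s δ C K₀ : ℝ) (ℓ₀ : ℕ → Fin Nf → ℕ), OutwardDecayWith Nf reg m s δ C K₀ ℓ₀ :=
  -- CLOSED (landed p119549, `Theorems/PauliWegnerSeaFMClosureUnquenchedClosureC1.lean` + Aux1–7, seat c1-0):
  -- the ASFH bootstrap (2.11)–(2.17) averaged, volume bootstrap + rate arithmetic, k-uniform constants.
  _root_.Summit.QuantumFields.QCD.Theorems.VonMisesCirclesC1.stub_closure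

/-! ## §5 Kernel-checked composition -/

/-- Merging the outward and inward packages at a common exponent `s` into the crux's `Conclusion`
(`δ = min`, `C = max`; pure bookkeeping, proved). -/
theorem conclusion_of_outward_inward {Nf : ℕ} (reg : QCDRegularisation Nf) (m : Fin Nf → ℝ)
    {s δ C K₀ δ' C' : ℝ} {ℓ₀ : ℕ → Fin Nf → ℕ}
    (hout : OutwardDecayWith Nf reg m s δ C K₀ ℓ₀) (hin : InwardDecayWith Nf reg m s δ' C' ℓ₀) :
    Conclusion Nf reg m := by
  obtain ⟨hs0, hs1, hδ, hC, -, -, hev⟩ := hout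
  obtain ⟨hδ', hC', hev'⟩ := hin
  refine ⟨s, min δ δ', max C C', hs0, hs1, lt_min hδ hδ', ?_⟩
  filter_upwards [hev, hev'] with k hk hk' S hS f v hv
  have ht : 0 ≤ reg.a k * ‖v‖ := mul_nonneg (reg.a_pos k).le (norm_nonneg v)
  have hmax : 0 ≤ max C C' := le_trans hC (le_max_left _ _)
  by_cases h : (ℓ₀ k f : ℝ) ≤ ‖v‖
  · calc cruxMoment Nf (reg.β k) (bareMass reg m k) S f v s
          ≤ C * Real.exp (-(δ * (reg.a k * ‖v‖))) := hk S hS f v hv h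
      _ ≤ max C C' * Real.exp (-(min δ δ' * (reg.a k * ‖v‖))) := by
          apply mul_le_mul (le_max_left _ _) _ (Real.exp_pos _).le hmax
          exact Real.exp_le_exp.mpr (neg_le_neg (mul_le_mul_of_nonneg_right (min_le_left _ _) ht))
  · have h : ‖v‖ < (ℓ₀ k f : ℝ) := lt_of_not_ge h
    calc cruxMoment Nf (reg.β k) (bareMass reg m k) S f v s
          ≤ C' * Real.exp (-(δ' * (reg.a k * ‖v‖))) := hk' S hS f v hv h
      _ ≤ max C C' * Real.exp (-(min δ δ' * (reg.a k * ‖v‖))) := by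
          apply mul_le_mul (le_max_right _ _) _ (Real.exp_pos _).le hmax
          exact Real.exp_le_exp.mpr (neg_le_neg (mul_le_mul_of_nonneg_right (min_le_right _ _) ht))

/-- **Composition.** The seven stub statements imply the crux BY NAME. Pure logic after the defeq
`crux_iff`: the circle law feeds the fibre band law, which with K1♭ feeds the two-star package; the
closure turns (two-star, far stability, resolvent algebra [landed], unit-shell corner, hopping window
[landed], input) into the outward package, the inward corner supplies the complementary package at the
same exponent, and `conclusion_of_outward_inward` merges them.  K1 and K3 (the crux's own hypotheses) are
consumed by `stub_farStability` (registry identity with the picked line).  The hypotheses are, in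
order, literally the types of `stub_circleLaw`, `stub_fibreBandLaw`, `stub_deterministic`,
`stub_twoStar`, `stub_farStability`, `stub_corners`, `stub_closure`. -/
theorem FMClosureUnquenched_of :
    FibreBandLaw →
    (LocalCofactorDomination ∧ SideWitness) →
    (FibreBandLaw → LocalCofactorDomination → SideWitness → ∀ Nf : ℕ, TwoStarBounds Nf) →
    (Summit.QuantumFields.QCD.Theses.PauliWegnerSea.FibreCofactorDomination →
      Summit.QuantumFields.QCD.Theses.PauliWegnerSea.TiltedFlatness → ∀ Nf : ℕ, FarStability Nf) →
    ((∀ Nf : ℕ, UnitShellLowerBound Nf) ∧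
      (∀ (Nf : ℕ) (reg : QCDRegularisation Nf) (m : Fin Nf → ℝ), (∀ f, 0 < m f) →
        InwardExtension Nf reg m)) →
    (∀ (Nf : ℕ) (reg : QCDRegularisation Nf) (m : Fin Nf → ℝ), (∀ f, 0 < m f) →
      TwoStarBounds Nf → FarStability Nf → CollarResolventBounds → UnitShellLowerBound Nf →
        HoppingDecay Nf → Input Nf reg m →
          ∃ (s δ C K₀ : ℝ) (ℓ₀ : ℕ → Fin Nf → ℕ), OutwardDecayWith Nf reg m s δ C K₀ ℓ₀) →
    Summit.QuantumFields.QCD.Theses.PauliWegnerSea.FMClosureUnquenched := by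
  intro h2 h3 h4 h5 h6 h7
  rw [crux_iff]
  intro hK1 hK3 Nf reg m hm hin
  have hT : TwoStarBounds Nf := h4 h2 h3.1 h3.2 Nf
  obtain ⟨s, δ, C, K₀, ℓ₀, hout⟩ :=
    h7 Nf reg m hm hT (h5 hK1 hK3 Nf) stub_resolvent (h6.1 Nf) (stub_hopping Nf) hin
  obtain ⟨δ', C', hinw⟩ := h6.2 Nf reg m hm hT hin s δ C K₀ ℓ₀ hout
  exact conclusion_of_outward_inward reg m hout hinw

/-- The composition instantiated with the registered stubs (so that, once every `stub_*` is proved,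
this very term closes the crux). -/
theorem FMClosureUnquenched_of_stubs :
    Summit.QuantumFields.QCD.Theses.PauliWegnerSea.FMClosureUnquenched :=
  FMClosureUnquenched_of fibreBandLaw_holds stub_deterministic stub_twoStar
    stub_farStability stub_corners stub_closure

/-- The fibre half alone, for the lead's registry: the picked line's `stub_twoStar` statement
(`K1 → K3 → ∀ Nf, TwoStarBounds Nf`) follows from stubs 1a, 1b, 2, 3 (K1, K3 unused). -/
theorem twoStar_of_circles (h2 : LocalCofactorDomination ∧ SideWitness) :
    Summit.QuantumFields.QCD.Theses.PauliWegnerSea.FibreCofactorDomination →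
      Summit.QuantumFields.QCD.Theses.PauliWegnerSea.TiltedFlatness →
        ∀ Nf : ℕ, TwoStarBounds Nf :=
  fun _ _ => stub_twoStar fibreBandLaw_holds h2.1 h2.2

end Summit.QuantumFields.QCD.Cruxes.FMClosureUnquenched.VonMisesCircles
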